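import Literature.MathematicalPhysics.QuantumFieldTheory.Balaban1983to89.B9Eq172FlatCurlPoincareZdPer
import Literature.MathematicalPhysics.QuantumFieldTheory.Balaban1983to89.B9Eq321LandauProjectionZdPer

/-!
# `Balaban1983to89.B9Thm311FlatKernelZdPer` — [Balaban1984PropagatorsI] (1.72) p. 30 and [Balaban1985BackgroundPropagators] Thm 3.11 p. 416 AT THE FLAT
# BACKGROUND ON THE TORUS `T_η` READ ON `ℤᵈ`: THE FLAT HODGE KERNEL — a `P`-periodic `𝔸`-valued bond field that is CLOSED (`D^η_1A = 0` on plaquettes),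
# CO-CLOSED (`D^{η*}_1A = 0` at sites) and has NO HARMONIC PART (zero cell sums) VANISHES; on the way, the torus Liouville theorem `Δ^η_1λ = 0 ⇒ λ` constant
# for periodic `λ` (faithful trace pairing).  This is the lattice-geometric core of print's «Δ_aA = 0 ⇒ A = 0» ((1.72) ⇒ «A₀ = 0, ω = 0») at `U = 1`, the
# `R(1)`- and `Q_k(1)`-letters entering only through its two displayed consequences `D^{η*}_1A = 0` and `Σ_cell A = 0`

statement-level skeleton of published theorems with citation tags; proofs where landed; nothing here is a claim about the
Yang–Mills mass gap

`[Balaban1984PropagatorsI]` ("B5", CMP **95** (1984) 17–40) p. 30: *«Thus if for some A we have Δ_aA = 0, then ΔA − dPd*A = 0, QA = 0. (1.72) From the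
first equation we get A = ∂Δ⁻²Q′*(Q′Δ⁻²Q′*)⁻¹ω + A₀ where A₀ is a constant vector function and ω is a function on unit lattice T₁^{(k)} orthogonal to
constant functions. The second equation in (1.72) implies … thus A₀ = 0, ω = 0 … This ends the proof of the lemma.»*; p. 22 *«[Δ] is a symmetric,
non-negative operator, and 0 is its eigenvalue. Constant functions form the eigenspace corresponding to the eigenvalue 0»*.
`[Balaban1985BackgroundPropagators]` ("B9", CMP **99** (1985) 389–434) (3.3)–(3.4) p. 391, (3.23) p. 394 (`Δ^η_{U₀} = D^{η*}_{U₀}D^η_{U₀}`), Thm 3.11 p. 416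
*«the operators Δ′_a, G′, (Q′G′²Q′*)⁻¹, Δ_a, G are positive definite … In [4] we have proved that the operator G_□(1) is positive»*.
`[Balaban1985RegularSpaces]` ("B8") p. 77 (the torus datum «Ω_j = T_η»), (1.1) p. 76, (1.38) p. 82 (the divergence `D^{η*}_{U₀}A`).
PDF held: `paper:balaban1984-cmp95-propagators-rt-i` pp. 22, 30; `paper:balaban1985-cmp99-background-propagators` pp. 391, 394, 416 (via the tree's
`B5Eq172PoincareTorus` ∕ `B5Eq172HodgePositivity` ∕ `B9Eq327GreenZdHermPer` docstrings, re-read 2026-08-28).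

CITATION HEADER (lean-in-tree rule).  Cell `pub-ymgap` (YM Track A, HUMAN RULINGS D-0062 ∕ D-0149), node N06 = [B9], width seat `pub-ymgap-dag-n06-w3` (g6),
CLAIM-2 (bus 2026-08-28 14:00Z ∕ 14:11Z; dag-lead g18 DEDUP-398 GO; letter owner dag-n06-b g22 «welcome — CLAIM-3 `opsAllZdPer` discharges the displayed
halves by name»).  WHY.  On the (β′-PERIODIC) road of record the N06 binder is dag-n06-b's `RegularInClassAtHPer` ∕ `InvAtHIPer` (`B9Eq327GreenZdHermPer`,
p638598): `G_𝔤^per(U₀) = (Δ_a)⁻¹` exists on the periodic Hermitian carrier `E_𝔤^per(P) = domSubHPer P`, supplied from POSITIVITY of the form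
(`regularAtHPer_of_bondPairPer_pos`).  Its A6 inhabitant at `U₀ = 1` for the GENUINE four-letter record (`opsAllZdPer`, dag-n06-b CLAIM-3) is print's
(1.72) argument: at the flat background the form is a sum of three squares `‖D¹A‖² + ‖R(1)D¹*A‖² + a‖Q_k(1)A‖²`, and their joint vanishing forces
`A = 0`.  THIS FILE proves the lattice-geometric heart of that implication on the N06 periodic carrier — with the `R(1)`-letter (dag-n06-w4's
`projRPer`, p639373) and the `Q_k(1)`-letter (dag-n06-b's `QQZdP` ∕ `linCovIterT`) entering ONLY through the two consequences the consumer discharges in one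
step each: CO-CLOSEDNESS `D^{η*}_1A = 0` («`R(1)D¹*A = 0` and `D¹*A ∈ Δ(N(Q′)) = range R(1)`», §3's `covDivB_one_covDerivFwd_add_const` reduces it to the
potential; §4 states this half directly against dag-n06-w4's `projRPer`) and ZERO CELL SUMS + Q′-NULL POTENTIAL («`Q_k(1)A = 0`: the flat averaging
preserves cell means, and `Q_k(1)D¹λ = D_coarse Q′_k(1)λ`»).  Inputs BY NAME: this seat's `B9Eq172FlatCurlPoincareZdPer`
(p639947: flat + zero cell sums ⟹ pure gauge `D¹λ`, `λ` periodic), dag-n06-b's `sum_box_pair_covDerivFwd_left` (summation by parts on the period cell),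
`B8Eq138LandauZd.covDivB ∕ covLap` (`Δ^η_{U₀} = D^{η*}_{U₀}D^η_{U₀}` by `rfl`).

WHAT IS PROVED (kernel, 0 sorry, 0 def; [folklore] discrete Hodge theory on a finite torus — the cited sentences are print's use of it).
* §1 ★ `sum_box_re_trace_covLap_one` (THE FLAT DIRICHLET-FORM IDENTITY ON THE CELL: `Σ_{x∈[0,P)ᵈ} Re τ(λ(x)* (Δ^η_1λ)(x)) = Σ_μ Σ_{x∈[0,P)ᵈ} Re τ((D^η_{1,μ}λ)(x)*
  (D^η_{1,μ}λ)(x))`, any periodic `λ`, any `τ`), ★★ `periodic_covDerivFwd_one_eq_zero_of_covLap_one_eq_zero` (TORUS LIOUVILLE, p. 22: `Δ^η_1λ = 0` on the cell,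
  `λ` periodic, `τ` faithful ⟹ `D^η_1λ ≡ 0`), ★ `periodic_eq_const_of_covLap_one_eq_zero` (⟹ `λ` constant, `η ≠ 0`).
* §2 ★★★ `eq_zero_of_flat_of_covDivB_one_eq_zero_of_sum_box_eq_zero` (THE FLAT HODGE KERNEL ON `T_P`, (1.72) ⇒ «A₀ = 0, ω = 0»): `A` `P`-periodic,
  `(D^η_1A)(p) = 0` ∀ p, `(D^{η*}_1A)(x) = 0` ∀ x ∈ cell, `Σ_{cell} A_μ = 0` ∀ μ ⟹ `A = 0`; ★★ `eq_zero_of_mem_domSubHPer_of_flat_kernel_data` (the same on the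
  carrier `E_𝔤^per(P)`, hypotheses on the cell only).
* §4 ★ `projRPer_covDivB_one_of_gaugeNullPer_potential` (`R(1)(D¹*D¹λ) = Δ¹λ` for `λ ∈ N_𝔤^per(Q′(1))`, dag-n06-w4's `projRPer` ∕
  `projEPer_covLap_of_mem_gaugeNullPer` BY NAME), ★★ `eq_zero_of_gaugeNullPer_potential_of_projRPer_covDivB_eq_zero` ((1.72)'s endgame), ★★★
  `eq_zero_of_mem_domSubHPer_of_flat_squares` (THE KERNEL WITH THE HALVES IN LETTER FORM: (D) flat on the cell, (Q₁) zero cell sums, (Q₂) the potential is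
  Q′(1)-null up to a constant, (R) `projRPer … 1 (D¹*A) = 0` ⟹ `A = 0`).
* §3 interface for the consumer's two one-step discharges: ★ `covDivB_one_covDerivFwd_add_const` (`D^{η*}_1(D^η_1λ + v) = Δ^η_1λ` — divergence kills
  constants; so the `R(1)`-half is a statement about the potential), `covDivB_one_const` , ★ `sum_box_eq_zero_iff_const_eq_zero_of_flat` (cell sums ⟷ the
  constant part of the Poincaré decomposition), ★★ `eq_zero_of_flat_of_potential_covLap_eq_zero` (closed + zero cell sums + «the (any) periodic potential is
  harmonic» ⟹ `A = 0` — the form in which «`D¹*A = Δ¹λ ∈ range R(1)` and `R(1)D¹*A = 0`» is consumed).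

HONEST SCOPE.  Count-neutral helper (`--supports` the K1 item of record): [folklore] lattice Hodge theory transported to the N06 periodic carrier; NO estimate
of [B9]; Thm 3.11 ∕ 3.3 NOT proved (this is the `U₀ = 1` KERNEL statement only, and only its `D*D`-geometric core — the `R(1)` ∕ `Q_k(1)` one-step
discharges are the consumer's, against dag-n06-w4's `projRPer` and dag-n06-b's periodic `QQZdP`); N05 ∕ N06 NOT discharged; K1 NOT closed; one finite `𝕋⁴`
programme at fixed `ε`, Bałaban as printed; R4 closes only the conditional finite-`𝕋⁴` rung `BalabanLadder.UV` — nothing continuum ∕ ℝ⁴ ∕ OS ∕ mass gap ∕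
Clay.  Unit `pub-ymgap-dag-n06-w3` (g6), 2026-08-28; NEW file importing `B9Eq172FlatCurlPoincareZdPer` and dag-n06-w4's `B9Eq321LandauProjectionZdPer` (p639373);
modifies nothing.  Net new unproved facts: 0.
-/

noncomputable section

open scoped BigOperators

namespace Literature.MathematicalPhysics.QuantumFieldTheory.Balaban1983to89.B9Thm311FlatKernelZdPer

open B7Prop1Explicit B7Eq78Linearization
open B8Ineq132 (covDerivFwd covDeriv)
open B8Eq146AExpansion (plaqCovDeriv)
open B8Eq138LandauZd (covDivB covLap)
open B8Eq191FlatStencils (covDerivFwd_flat_apply covDeriv_flat_apply)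
open T4TermwiseTorus (IsPeriodic box tcls tlift tlift_mem_box)
open B9Eq327GreenZdHermPer (domSubHPer sum_box_shift sum_box_pair_covDerivFwd_left isPeriodic_covDerivFwd isPeriodic_comp_add isPeriodic_apply_dir)
open B9Eq172FlatCurlPoincareZdPer (exists_periodic_potential_add_const_of_flat exists_periodic_potential_of_flat_of_sum_box_eq_zero
  exists_herm_periodic_potential_add_const_of_flat card_smul_const_eq_sum_box_of_flat periodic_eq_const_of_covDerivFwd_one_eq_zero sum_box_covDerivFwd_one)
open B9Eq321LandauProjectionZdPer (perSub perRestrict perRestrict_eq_self perRestrict_mem_perSub gaugeNullPer projEPer projRPer covLap_mem_perSub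
  projEPer_covLap_of_mem_gaugeNullPer)

-- `Site` alone could resolve to the torus sites of `Setup.lean`; re-export the `ℤ^d` sites of `B7Prop1Explicit`.
export B7Prop1Explicit (Site)

variable {d : ℕ} {𝔸 : Type*} [CStarAlgebra 𝔸]

/-! ## §1  The flat Dirichlet form on the period cell and the torus Liouville theorem -/

section Liouville

variable (τ : 𝔸 →ₗ[ℂ] ℂ) (P : ℕ) [NeZero P] (η : ℝ)

omit [NeZero P] in
/-- the flat background `U₀ ≡ 1` is periodic. [folklore] -/
private theorem one_periodic : IsPeriodic P (1 : Site d → Fin d → 𝔸ˣ) := fun _ _ => rfl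

/-- ★ **THE FLAT DIRICHLET-FORM IDENTITY ON THE PERIOD CELL** ([B9] (3.23) `Δ^η_1 = D^{η*}_1D^η_1` paired against `λ` and summed by parts on the torus):
`Σ_{x∈[0,P)ᵈ} Re τ(λ(x)* (Δ^η_1λ)(x)) = Σ_μ Σ_{x∈[0,P)ᵈ} Re τ((D^η_{1,μ}λ)(x)* (D^η_{1,μ}λ)(x))` for every `P`-periodic site function `λ` — dag-n06-b's
`sum_box_pair_covDerivFwd_left` direction by direction (structure group `⊥`, no unitarity or trace property needed at `U₀ = 1`).
[cite: Balaban1985BackgroundPropagators, (3.23) p.394, p.391; Balaban1984PropagatorsI, p.22 («a symmetric, non-negative operator»)] -/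
theorem sum_box_re_trace_covLap_one {lam : Site d → 𝔸} (hlam : IsPeriodic P lam) :
    ∑ x ∈ box (d := d) P, (τ (star (lam x) * covLap η (1 : Site d → Fin d → 𝔸ˣ) lam x)).re =
      ∑ μ : Fin d, ∑ x ∈ box (d := d) P,
        (τ (star (covDerivFwd η (1 : Site d → Fin d → 𝔸ˣ) μ lam x) * covDerivFwd η (1 : Site d → Fin d → 𝔸ˣ) μ lam x)).re := by
  have hD : ∀ μ, IsPeriodic P (covDerivFwd η (1 : Site d → Fin d → 𝔸ˣ) μ lam) := fun μ => isPeriodic_covDerivFwd η (one_periodic P) μ hlam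
  -- the trace pairing `(a, b) ↦ Re τ(a* b)` as a real bilinear map (dag-n06-b's `Bτ`), invariant under the trivial structure group `⊥ = {1}`
  let Bτ : 𝔸 →ₗ[ℝ] 𝔸 →ₗ[ℝ] ℝ :=
    LinearMap.mk₂ ℝ (fun a b => (τ (star a * b)).re)
      (fun a₁ a₂ b => by rw [star_add, add_mul, map_add, Complex.add_re])
      (fun c a b => by
        rw [star_smul, star_trivial, smul_mul_assoc, ← Complex.coe_smul, map_smul, smul_eq_mul, smul_eq_mul, Complex.re_ofReal_mul])
      (fun a b₁ b₂ => by rw [mul_add, map_add, Complex.add_re])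
      (fun c a b => by rw [mul_smul_comm, ← Complex.coe_smul, map_smul, smul_eq_mul, smul_eq_mul, Complex.re_ofReal_mul])
  have hBapp : ∀ a b : 𝔸, Bτ a b = (τ (star a * b)).re := fun _ _ => rfl
  have hB : ∀ u ∈ (⊥ : Subgroup 𝔸ˣ), ∀ a b : 𝔸, Bτ (conjR u a) b = Bτ a (conjR u⁻¹ b) := by
    intro u hu a b
    rw [Subgroup.mem_bot] at hu
    subst hu
    rw [inv_one, B8Ineq132.one_conjR, B8Ineq132.one_conjR]
  -- unfold `Δ^η_1 = Σ_μ D^{η*}_{1,μ} D^η_{1,μ}` and distribute the pairing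
  have h1 : ∀ x, (τ (star (lam x) * covLap η (1 : Site d → Fin d → 𝔸ˣ) lam x)).re =
      ∑ μ : Fin d, Bτ (lam x) (covDeriv η (1 : Site d → Fin d → 𝔸ˣ) μ (covDerivFwd η (1 : Site d → Fin d → 𝔸ˣ) μ lam) x) := by
    intro x
    rw [← hBapp, covLap, covDivB, map_sum]
  rw [Finset.sum_congr rfl fun x _ => h1 x, Finset.sum_comm]
  refine Finset.sum_congr rfl fun μ _ => ?_
  rw [← sum_box_pair_covDerivFwd_left Bτ (⊥ : Subgroup 𝔸ˣ) P η (1 : Site d → Fin d → 𝔸ˣ) hB μ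
    (fun _ => (⊥ : Subgroup 𝔸ˣ).one_mem) (one_periodic P) hlam (hD μ)]
  exact Finset.sum_congr rfl fun x _ => hBapp _ _

/-- each diagonal term `Re τ(a* a)` is non-negative for a faithful positive trace. [folklore] -/
private theorem re_trace_star_mul_self_nonneg (hτp : ∀ a : 𝔸, a ≠ 0 → 0 < (τ (star a * a)).re) (a : 𝔸) :
    0 ≤ (τ (star a * a)).re := by
  by_cases ha : a = 0
  · rw [ha, mul_zero, map_zero, Complex.zero_re]
  · exact (hτp a ha).le

/-- ★★ **TORUS LIOUVILLE AT THE FLAT BACKGROUND** ([B5] p. 22: the kernel of the torus Laplacian is the constants): a `P`-periodic site function with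
`(Δ^η_1λ)(x) = 0` on the cell `[0,P)ᵈ` has `D^η_1λ ≡ 0` — by §1's identity the Dirichlet form `Σ_μ Σ_cell Re τ|D^η_{1,μ}λ|²` vanishes, each term is `≥ 0`
for a faithful `τ`, and `D^η_1λ` is periodic. [cite: Balaban1984PropagatorsI, p.22; Balaban1985BackgroundPropagators, (3.23) p.394] -/
theorem periodic_covDerivFwd_one_eq_zero_of_covLap_one_eq_zero (hτp : ∀ a : 𝔸, a ≠ 0 → 0 < (τ (star a * a)).re) {lam : Site d → 𝔸}
    (hlam : IsPeriodic P lam) (hΔ : ∀ x ∈ box (d := d) P, covLap η (1 : Site d → Fin d → 𝔸ˣ) lam x = 0) (μ : Fin d) (x : Site d) :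
    covDerivFwd η (1 : Site d → Fin d → 𝔸ˣ) μ lam x = 0 := by
  have hD : IsPeriodic P (covDerivFwd η (1 : Site d → Fin d → 𝔸ˣ) μ lam) := isPeriodic_covDerivFwd η (one_periodic P) μ hlam
  -- the Dirichlet form vanishes
  have hsum : ∑ ν : Fin d, ∑ y ∈ box (d := d) P,
      (τ (star (covDerivFwd η (1 : Site d → Fin d → 𝔸ˣ) ν lam y) * covDerivFwd η (1 : Site d → Fin d → 𝔸ˣ) ν lam y)).re = 0 := by
    rw [← sum_box_re_trace_covLap_one τ P η hlam]
    exact Finset.sum_eq_zero fun y hy => by rw [hΔ y hy, mul_zero, map_zero, Complex.zero_re]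
  -- every term is non-negative, hence zero on the cell
  have hterm : ∀ ν : Fin d, ∀ y ∈ box (d := d) P,
      (τ (star (covDerivFwd η (1 : Site d → Fin d → 𝔸ˣ) ν lam y) * covDerivFwd η (1 : Site d → Fin d → 𝔸ˣ) ν lam y)).re = 0 := by
    have hnn : ∀ ν ∈ (Finset.univ : Finset (Fin d)), 0 ≤ ∑ y ∈ box (d := d) P,
        (τ (star (covDerivFwd η (1 : Site d → Fin d → 𝔸ˣ) ν lam y) * covDerivFwd η (1 : Site d → Fin d → 𝔸ˣ) ν lam y)).re :=
      fun ν _ => Finset.sum_nonneg fun y _ => re_trace_star_mul_self_nonneg τ hτp _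
    intro ν y hy
    have hν := (Finset.sum_eq_zero_iff_of_nonneg hnn).1 hsum ν (Finset.mem_univ ν)
    exact (Finset.sum_eq_zero_iff_of_nonneg fun z _ => re_trace_star_mul_self_nonneg τ hτp _).1 hν y hy
  -- read `x` on the cell by periodicity and conclude by faithfulness
  rw [← hD.apply_tlift x]
  by_contra hne
  have hpos := hτp _ hne
  rw [hterm μ _ (tlift_mem_box _)] at hpos
  exact lt_irrefl _ hpos

/-- ★ **A PERIODIC HARMONIC SITE FUNCTION IS CONSTANT** (`η ≠ 0`): `Δ^η_1λ = 0` on the cell ⟹ `λ(x) = λ(0)`.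
[cite: Balaban1984PropagatorsI, p.22 («Constant functions form the eigenspace corresponding to the eigenvalue 0»)] -/
theorem periodic_eq_const_of_covLap_one_eq_zero (hτp : ∀ a : 𝔸, a ≠ 0 → 0 < (τ (star a * a)).re) {η : ℝ} (hη : η ≠ 0) {lam : Site d → 𝔸}
    (hlam : IsPeriodic P lam) (hΔ : ∀ x ∈ box (d := d) P, covLap η (1 : Site d → Fin d → 𝔸ˣ) lam x = 0) (x : Site d) : lam x = lam 0 :=
  periodic_eq_const_of_covDerivFwd_one_eq_zero P hη hlam (periodic_covDerivFwd_one_eq_zero_of_covLap_one_eq_zero τ P η hτp hlam hΔ) x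

end Liouville

/-! ## §3 (stated first, used in §2)  Divergence of the Poincaré decomposition; cell sums versus the constant part -/

section Interface

variable (P : ℕ) [NeZero P] (η : ℝ)

/-- **the flat divergence kills constant bond fields**: `D^{η*}_1 v = 0`. [cite: Balaban1985RegularSpaces, (1.1) p.76, (1.38) p.82] -/
theorem covDivB_one_const (v : Fin d → 𝔸) (x : Site d) : covDivB η (1 : Site d → Fin d → 𝔸ˣ) (fun (_ : Site d) (κ : Fin d) => v κ) x = 0 := by
  rw [covDivB]
  exact Finset.sum_eq_zero fun μ _ => by rw [covDeriv_flat_apply, sub_self, smul_zero]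

/-- ★ **THE DIVERGENCE OF THE POINCARÉ DECOMPOSITION IS THE LAPLACIAN OF THE POTENTIAL**: `D^{η*}_1(D^η_1λ + v) = Δ^η_1λ` ([B9] (3.23) `Δ^η = D^{η*}D^η`, by
`rfl` in the tree, plus `D^{η*}_1 v = 0`) — so the co-closedness hypothesis of §2, and the consumer's «`R(1)D¹*A = 0`», are statements about `Δ^η_1λ`.
[cite: Balaban1985BackgroundPropagators, (3.23) p.394, (3.3) p.391; Balaban1985RegularSpaces, (1.38) p.82] -/
theorem covDivB_one_covDerivFwd_add_const (lam : Site d → 𝔸) (v : Fin d → 𝔸) (x : Site d) :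
    covDivB η (1 : Site d → Fin d → 𝔸ˣ) (fun y κ => covDerivFwd η (1 : Site d → Fin d → 𝔸ˣ) κ lam y + v κ) x =
      covLap η (1 : Site d → Fin d → 𝔸ˣ) lam x := by
  rw [covLap, covDivB, covDivB]
  refine Finset.sum_congr rfl fun μ _ => ?_
  simp only [covDeriv_flat_apply, add_sub_add_right_eq_sub]

/-- ★ **CELL SUMS ⟷ THE CONSTANT PART**: in a Poincaré decomposition `A = D^η_1λ + v` with `λ` periodic, `Σ_{cell} A_μ = 0 ⟺ v_μ = 0` (`P ≠ 0`) — the form in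
which the consumer's «`Q_k(1)A = 0` ⟹ no harmonic part» is consumed. [cite: Balaban1984PropagatorsI, (1.72) p.30 («thus A₀ = 0»)] -/
theorem sum_box_eq_zero_iff_const_eq_zero_of_flat {A : Site d → Fin d → 𝔸} {lam : Site d → 𝔸} {v : Fin d → 𝔸} (hlam : IsPeriodic P lam)
    (hdec : ∀ (x : Site d) (μ : Fin d), A x μ = covDerivFwd η (1 : Site d → Fin d → 𝔸ˣ) μ lam x + v μ) (μ : Fin d) :
    ∑ x ∈ box (d := d) P, A x μ = 0 ↔ v μ = 0 := by
  have h := card_smul_const_eq_sum_box_of_flat P η hlam hdec μ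
  rw [← h, ← Nat.cast_smul_eq_nsmul ℝ, smul_eq_zero]
  have hP : ((P ^ d : ℕ) : ℝ) ≠ 0 := by exact_mod_cast pow_ne_zero d (NeZero.ne P)
  exact ⟨fun h' => h'.resolve_left hP, fun h' => Or.inr h'⟩

end Interface

/-! ## §2  The flat Hodge kernel on `T_P` -/

section Kernel

variable (τ : 𝔸 →ₗ[ℂ] ℂ) (P : ℕ) [NeZero P] {η : ℝ}

/-- ★★ **CLOSED + NO HARMONIC PART + HARMONIC POTENTIAL ⟹ ZERO**: a `P`-periodic bond field with `(D^η_1A)(p) = 0` everywhere and zero cell sums is a pure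
gauge `D^η_1λ` (`B9Eq172FlatCurlPoincareZdPer`); if SOME periodic potential `λ` of it — they differ by constants, so ANY — is harmonic on the cell,
`Δ^η_1λ = 0`, then `A = 0` (torus Liouville).  This is the form the `R(1)`-half takes for the consumer: «`D^{η*}_1A = Δ^η_1λ ∈ Δ(N) ⊆ range R(1)` and
`R(1)D^{η*}_1A = 0` ⟹ `Δ^η_1λ = 0`». [cite: Balaban1984PropagatorsI, (1.72) p.30, p.22; Balaban1985BackgroundPropagators, Thm 3.11 p.416, (3.23) p.394] -/
theorem eq_zero_of_flat_of_potential_covLap_eq_zero (hτp : ∀ a : 𝔸, a ≠ 0 → 0 < (τ (star a * a)).re) (hη : η ≠ 0) {A : Site d → Fin d → 𝔸}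
    (hA : IsPeriodic P A) (hflat : ∀ (μ ν : Fin d) (x : Site d), plaqCovDeriv η (1 : Site d → Fin d → 𝔸ˣ) A μ ν x = 0)
    (hsum : ∀ μ : Fin d, ∑ x ∈ box (d := d) P, A x μ = 0)
    (hharm : ∀ lam : Site d → 𝔸, IsPeriodic P lam → (∀ (x : Site d) (μ : Fin d), A x μ = covDerivFwd η (1 : Site d → Fin d → 𝔸ˣ) μ lam x) →
      ∀ x ∈ box (d := d) P, covLap η (1 : Site d → Fin d → 𝔸ˣ) lam x = 0) :
    A = 0 := by
  obtain ⟨lam, hper, hdec⟩ := exists_periodic_potential_of_flat_of_sum_box_eq_zero P hη hA hflat hsum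
  have hD := periodic_covDerivFwd_one_eq_zero_of_covLap_one_eq_zero τ P η hτp hper (hharm lam hper hdec)
  funext x μ
  rw [hdec x μ, hD μ x, Pi.zero_apply, Pi.zero_apply]

/-- ★★★ **THE FLAT HODGE KERNEL ON THE TORUS `T_P` READ ON `ℤᵈ`** ([B5] (1.72) ⇒ «A₀ = 0, ω = 0»; the `U = 1` kernel statement behind [B9] Thm 3.11's «G_□(1)
is positive»): a `P`-periodic `𝔸`-valued bond field which is CLOSED (`(D^η_1A)(p) = 0` at every plaquette), CO-CLOSED on the cell (`(D^{η*}_1A)(x) = 0`,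
`x ∈ [0,P)ᵈ`) and has ZERO CELL SUMS (`Σ_{x∈[0,P)ᵈ} A(x)_μ = 0` — no harmonic∕constant part) VANISHES (`η ≠ 0`, `τ` faithful).  MECHANISM: Poincaré (flat + zero
cell sums ⟹ `A = D^η_1λ`, `λ` periodic), `D^{η*}_1D^η_1 = Δ^η_1`, torus Liouville.  The two letters `R(1)`, `Q_k(1)` of the genuine record enter the flat
kernel of Thm 3.11 ONLY through the last two hypotheses. [cite: Balaban1984PropagatorsI, (1.72) p.30, p.22; Balaban1985BackgroundPropagators, Thm 3.11 p.416, (3.3)–(3.4) p.391, (3.23) p.394; Balaban1985RegularSpaces, (1.38) p.82, p.77] -/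
theorem eq_zero_of_flat_of_covDivB_one_eq_zero_of_sum_box_eq_zero (hτp : ∀ a : 𝔸, a ≠ 0 → 0 < (τ (star a * a)).re) (hη : η ≠ 0)
    {A : Site d → Fin d → 𝔸} (hA : IsPeriodic P A)
    (hflat : ∀ (μ ν : Fin d) (x : Site d), plaqCovDeriv η (1 : Site d → Fin d → 𝔸ˣ) A μ ν x = 0)
    (hdiv : ∀ x ∈ box (d := d) P, covDivB η (1 : Site d → Fin d → 𝔸ˣ) A x = 0)
    (hsum : ∀ μ : Fin d, ∑ x ∈ box (d := d) P, A x μ = 0) :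
    A = 0 := by
  refine eq_zero_of_flat_of_potential_covLap_eq_zero τ P hτp hη hA hflat hsum fun lam _ hdec x hx => ?_
  have hAfun : A = fun y κ => covDerivFwd η (1 : Site d → Fin d → 𝔸ˣ) κ lam y + (0 : Fin d → 𝔸) κ := by
    funext y κ; rw [hdec y κ, Pi.zero_apply, add_zero]
  rw [← covDivB_one_covDerivFwd_add_const η lam 0 x, ← hAfun]
  exact hdiv x hx

/-- ★★ **THE FLAT HODGE KERNEL ON THE HERMITIAN PERIODIC CARRIER `E_𝔤^per(P)`** (dag-n06-b's `domSubHPer P`, the domain of `RegularAtHPer` ∕ `InvAtHIPer`):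
for `A ∈ domSubHPer P`, closedness on the cell's plaquettes `ν < κ` (the index range of the energy identity `sum_box_pair_Jcur`), co-closedness on the cell and
zero cell sums force `A = 0`. [cite: Balaban1984PropagatorsI, (1.72) p.30; Balaban1985BackgroundPropagators, Thm 3.11 p.416, (3.27) p.395, (3.10) p.392] -/
theorem eq_zero_of_mem_domSubHPer_of_flat_kernel_data (hτp : ∀ a : 𝔸, a ≠ 0 → 0 < (τ (star a * a)).re) (hη : η ≠ 0)
    {A : Site d → Fin d → 𝔸} (hA : A ∈ domSubHPer (d := d) (𝔸 := 𝔸) P)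
    (hflat : ∀ (κ : Fin d), ∀ ν ∈ Finset.Iio κ, ∀ x ∈ box (d := d) P, plaqCovDeriv η (1 : Site d → Fin d → 𝔸ˣ) A ν κ x = 0)
    (hdiv : ∀ x ∈ box (d := d) P, covDivB η (1 : Site d → Fin d → 𝔸ˣ) A x = 0)
    (hsum : ∀ μ : Fin d, ∑ x ∈ box (d := d) P, A x μ = 0) :
    A = 0 :=
  eq_zero_of_flat_of_covDivB_one_eq_zero_of_sum_box_eq_zero τ P hτp hη hA.1
    (B9Eq172FlatCurlPoincareZdPer.plaqCovDeriv_one_eq_zero_of_lt_of_mem_box P hA.1 hflat) hdiv hsum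

omit [NeZero P] in
/-- **A6 ∕ NON-VACUITY OF THE HYPOTHESES**: the zero field satisfies all three kernel conditions (so the kernel theorem is an `↔` with `A = 0`).
[cite: Balaban1984PropagatorsI, (1.72) p.30 (bookkeeping)] -/
theorem flat_kernel_data_zero (x : Site d) (μ ν : Fin d) :
    plaqCovDeriv η (1 : Site d → Fin d → 𝔸ˣ) (0 : Site d → Fin d → 𝔸) μ ν x = 0 ∧
      covDivB η (1 : Site d → Fin d → 𝔸ˣ) (0 : Site d → Fin d → 𝔸) x = 0 ∧
      ∑ y ∈ box (d := d) P, (0 : Site d → Fin d → 𝔸) y μ = 0 := by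
  refine ⟨?_, ?_, by simp⟩
  · rw [B9Eq172FlatCurlPoincareZdPer.plaqCovDeriv_one_apply]
    simp
  · rw [covDivB]
    exact Finset.sum_eq_zero fun κ _ => by rw [covDeriv_flat_apply]; simp

end Kernel


/-! ## §4  The `R(1)`-half against dag-n06-w4's periodic Landau projection `projRPer` ((3.21)–(3.22) on `T_P`) -/

section Landau

variable (τ : 𝔸 →ₗ[ℂ] ℂ) (P L m : ℕ) [NeZero P] (Λs : ℕ → Set (Site d)) {η : ℝ}

omit [NeZero P] in
/-- a flat pure gauge does not see a constant shift of its potential: `D^η_1(λ − c) = D^η_1λ`. [cite: Balaban1985BackgroundPropagators, (3.3) p.391] -/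
theorem covDerivFwd_one_sub_const (η : ℝ) (lam : Site d → 𝔸) (c : 𝔸) (μ : Fin d) (x : Site d) :
    covDerivFwd η (1 : Site d → Fin d → 𝔸ˣ) μ (fun y => lam y - c) x = covDerivFwd η (1 : Site d → Fin d → 𝔸ˣ) μ lam x := by
  rw [covDerivFwd_flat_apply, covDerivFwd_flat_apply, sub_sub_sub_cancel_right]

/-- ★ **`R(1)` FIXES THE DIVERGENCE OF A PURE GAUGE WITH POTENTIAL IN `N_𝔤^per(Q′(1))`**: for `λ ∈ gaugeNullPer P L m Λs 1` and `A = D^η_1λ`,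
`R(1)(D^{η*}_1A) = D^{η*}_1A = Δ^η_1λ` — `D^{η*}_1A = Δ^η_1λ` is a GENERATOR of `R = Δ^η_1N^per(Q′)` (dag-n06-w4's `projEPer_covLap_of_mem_gaugeNullPer`), read
through `projRPer` (periodisation by representatives is the identity on the periodic `Δ^η_1λ`). [cite: Balaban1985BackgroundPropagators, (3.21)–(3.22) p.394, (3.23) p.394; Balaban1984PropagatorsI, (1.72) p.30] -/
theorem projRPer_covDivB_one_of_gaugeNullPer_potential [FiniteDimensional ℝ 𝔸] (hτs : ∀ a : 𝔸, τ (star a) = starRingEnd ℂ (τ a))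
    (hτp : ∀ a : 𝔸, a ≠ 0 → 0 < (τ (star a * a)).re) {lam : Site d → 𝔸}
    (hlam : lam ∈ gaugeNullPer P L m Λs (1 : Site d → Fin d → 𝔸ˣ)) {A : Site d → Fin d → 𝔸}
    (hdec : ∀ (x : Site d) (μ : Fin d), A x μ = covDerivFwd η (1 : Site d → Fin d → 𝔸ˣ) μ lam x) :
    projRPer τ P L m η Λs (1 : Site d → Fin d → 𝔸ˣ) (covDivB η (1 : Site d → Fin d → 𝔸ˣ) A) = covLap η (1 : Site d → Fin d → 𝔸ˣ) lam := by
  have hU : IsPeriodic P (1 : Site d → Fin d → 𝔸ˣ) := fun _ _ => rfl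
  -- `D^{η*}_1A = Δ^η_1λ`
  have hAfun : A = fun y κ => covDerivFwd η (1 : Site d → Fin d → 𝔸ˣ) κ lam y + (0 : Fin d → 𝔸) κ := by
    funext y κ; rw [hdec y κ, Pi.zero_apply, add_zero]
  have hdiv : covDivB η (1 : Site d → Fin d → 𝔸ˣ) A = covLap η (1 : Site d → Fin d → 𝔸ˣ) lam := by
    funext x; rw [hAfun, covDivB_one_covDerivFwd_add_const]
  -- periodisation by representatives is the identity on the periodic `Δ^η_1λ`
  have hper : IsPeriodic P (covLap η (1 : Site d → Fin d → 𝔸ˣ) lam) := covLap_mem_perSub hU hlam.2.1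
  have hsub : (⟨perRestrict P (covLap η (1 : Site d → Fin d → 𝔸ˣ) lam), perRestrict_mem_perSub P _⟩ : perSub (𝔸 := 𝔸) (d := d) P) =
      ⟨covLap η (1 : Site d → Fin d → 𝔸ˣ) lam, covLap_mem_perSub hU hlam.2.1⟩ :=
    Subtype.ext (perRestrict_eq_self P hper)
  rw [hdiv, projRPer, hsub, projEPer_covLap_of_mem_gaugeNullPer L m η Λs (1 : Site d → Fin d → 𝔸ˣ) hτs hτp hU hlam]

/-- ★★ **(1.72)'s ENDGAME ON `T_P`: A PURE GAUGE WITH POTENTIAL IN `N_𝔤^per(Q′(1))` AND `R(1)D^{η*}_1A = 0` VANISHES** — `R(1)` fixes `D^{η*}_1A = Δ^η_1λ`,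
so the hypothesis says `Δ^η_1λ = 0`; torus Liouville. [cite: Balaban1984PropagatorsI, (1.72) p.30 («thus … ω = 0»), p.22; Balaban1985BackgroundPropagators, (3.21)–(3.23) p.394, Thm 3.11 p.416] -/
theorem eq_zero_of_gaugeNullPer_potential_of_projRPer_covDivB_eq_zero [FiniteDimensional ℝ 𝔸] (hτs : ∀ a : 𝔸, τ (star a) = starRingEnd ℂ (τ a))
    (hτp : ∀ a : 𝔸, a ≠ 0 → 0 < (τ (star a * a)).re) {lam : Site d → 𝔸}
    (hlam : lam ∈ gaugeNullPer P L m Λs (1 : Site d → Fin d → 𝔸ˣ)) {A : Site d → Fin d → 𝔸}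
    (hdec : ∀ (x : Site d) (μ : Fin d), A x μ = covDerivFwd η (1 : Site d → Fin d → 𝔸ˣ) μ lam x)
    (hR : projRPer τ P L m η Λs (1 : Site d → Fin d → 𝔸ˣ) (covDivB η (1 : Site d → Fin d → 𝔸ˣ) A) = 0) :
    A = 0 := by
  have hΔ : covLap η (1 : Site d → Fin d → 𝔸ˣ) lam = 0 := by
    rw [← projRPer_covDivB_one_of_gaugeNullPer_potential τ P L m Λs hτs hτp hlam hdec, hR]
  have hD := periodic_covDerivFwd_one_eq_zero_of_covLap_one_eq_zero τ P η hτp hlam.2.1 (fun x _ => by rw [hΔ, Pi.zero_apply])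
  funext x μ
  rw [hdec x μ, hD μ x, Pi.zero_apply, Pi.zero_apply]

/-- ★★★ **THE FLAT KERNEL OF THE GENUINE RECORD ON `T_P`, WITH THE TWO HALVES DISPLAYED IN LETTER FORM** — for `A ∈ E_𝔤^per(P)`:
(D) `(D^η_1A)(p) = 0` on the cell's plaquettes `ν < κ` (the `D*D` square); (Q₁) zero cell sums and (Q₂) «every Hermitian periodic potential of `A` is in
`N_𝔤^per(Q′(1))` up to a constant» (the two consequences of the `Q_k(1)` square the consumer supplies from the flat averaging); (R) `R(1)(D^{η*}_1A) = 0`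
(the `DR(1)D*` square, dag-n06-w4's `projRPer`) ⟹ `A = 0`.  MECHANISM: Poincaré with Hermitian data (p639947) + (Q₁) ⟹ pure gauge; (Q₂) ⟹ potential in
`N^per`; §4. [cite: Balaban1984PropagatorsI, (1.72) p.30; Balaban1985BackgroundPropagators, Thm 3.11 p.416, (3.21)–(3.23) p.394, (3.27) p.395] -/
theorem eq_zero_of_mem_domSubHPer_of_flat_squares [FiniteDimensional ℝ 𝔸] (hτs : ∀ a : 𝔸, τ (star a) = starRingEnd ℂ (τ a))
    (hτp : ∀ a : 𝔸, a ≠ 0 → 0 < (τ (star a * a)).re) (hη : η ≠ 0) {A : Site d → Fin d → 𝔸} (hA : A ∈ domSubHPer (d := d) (𝔸 := 𝔸) P)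
    (hflat : ∀ (κ : Fin d), ∀ ν ∈ Finset.Iio κ, ∀ x ∈ box (d := d) P, plaqCovDeriv η (1 : Site d → Fin d → 𝔸ˣ) A ν κ x = 0)
    (hsum : ∀ μ : Fin d, ∑ x ∈ box (d := d) P, A x μ = 0)
    (hnull : ∀ lam : Site d → 𝔸, IsPeriodic P lam → (∀ x, IsSelfAdjoint (lam x)) →
      (∀ (x : Site d) (μ : Fin d), A x μ = covDerivFwd η (1 : Site d → Fin d → 𝔸ˣ) μ lam x) →
      ∃ c : 𝔸, (fun y => lam y - c) ∈ gaugeNullPer P L m Λs (1 : Site d → Fin d → 𝔸ˣ))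
    (hR : projRPer τ P L m η Λs (1 : Site d → Fin d → 𝔸ˣ) (covDivB η (1 : Site d → Fin d → 𝔸ˣ) A) = 0) :
    A = 0 := by
  have hflat' := B9Eq172FlatCurlPoincareZdPer.plaqCovDeriv_one_eq_zero_of_lt_of_mem_box P hA.1 hflat
  obtain ⟨lam, v, hper, hsa, -, hdec⟩ := exists_herm_periodic_potential_add_const_of_flat P hη hA hflat'
  -- (Q₁): the constant part vanishes
  have hv : ∀ μ, v μ = 0 := fun μ => (sum_box_eq_zero_iff_const_eq_zero_of_flat P η hper hdec μ).1 (hsum μ)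
  have hdec' : ∀ (x : Site d) (μ : Fin d), A x μ = covDerivFwd η (1 : Site d → Fin d → 𝔸ˣ) μ lam x := fun x μ => by
    rw [hdec x μ, hv μ, add_zero]
  -- (Q₂): correct the potential by a constant into `N^per`
  obtain ⟨c, hc⟩ := hnull lam hper hsa hdec'
  have hdec'' : ∀ (x : Site d) (μ : Fin d), A x μ = covDerivFwd η (1 : Site d → Fin d → 𝔸ˣ) μ (fun y => lam y - c) x := fun x μ => by
    rw [covDerivFwd_one_sub_const, hdec' x μ]
  exact eq_zero_of_gaugeNullPer_potential_of_projRPer_covDivB_eq_zero τ P L m Λs hτs hτp hc hdec'' hR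

end Landau

end Literature.MathematicalPhysics.QuantumFieldTheory.Balaban1983to89.B9Thm311FlatKernelZdPer

end
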